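import Literature.MathematicalPhysics.QuantumFieldTheory.Balaban1983to89.NodeOTorusBlocks

/-!
# `Balaban1983to89.NodeOTorusLemma24` — T. Bałaban, *Propagators and renormalization transformations for lattice gauge theories. II*, CMP **96**
# (1984) 223–250 [Balaban1984PropagatorsII] Lemma 2.4 (2.128) p. 245, with [Balaban1985BackgroundPropagators] (3.35)–(3.36) p. 396 and p. 428: **LEMMA 2.4
# ON THE TORUS — the unit-weight (2.128) `k·Σ_b B_b² ≤ L^{d−2}·Σ_c (L^{−(d+1)}·qSum B c)² + Σ_p (curlSum B p)²`, `k = (κ₁∕(12d²))·L^{−(d+1)}`, for periodic fields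
# vanishing on the block axial trees and outside a window of blocks, FROM THE TREE's `ℤ^d` THEOREM `B6Lemma24Kappa.lemma24_printedShape_kappa1` BY THE PERIODIC LIFT**

statement-level skeleton of published theorems with citation tags; proofs where landed; nothing here is a claim about the Yang–Mills mass gap

CITATION HEADER (lean-in-tree rule).  Ideation cell `ym-nodeO-ideate` (portfolio track, 2026-08-25), seat P1 «inside Bałaban», memo
`memos/ROUTE-P1.md` v3.17 (sha256 d4d6d9a6…) §0q (FINDINGS F10∕F11) and §0p (F9).  LANDING EDITION (generation 12, F-series module 2∕5) of the memo
companion `memos/ROUTE-P1-SketchLift.lean` («companion 8», sha256 429c7622…) §5 and its four transport lemmas (lines 376–593); referee track = the cell's `STATUS.md` (REF∕LIT verdict lines on v3.17 and on this edition are the filing precondition; the courier files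
REF-named editions only, unchanged; director-ym LINE №2 (B), operator 2026-08-25T18:24:34Z).  Statements and proofs below are CHARACTER-IDENTICAL to the
companion's; edition deltas = the namespace (`YMNodeOIdeate.P1.Lift` → this module's), this header, the import of module 1 `NodeOTorusBlocks` (companion §1–§4) with `open NodeOTorusBlocks` and the re-opened `section Lift` (same `variable` line), the companion's `open …Balaban1983to89` line dropped
(the opens now resolve inside the tree namespace), bare `Plaq`∕`block` spelled `B9SectCLatticeCarrier.Plaq`∕`B6Elimination.block` in code (inside the tree
namespace the topic root's `Setup.lean` `Plaq`∕`block` shadow the opens),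
for the gate lint `literature-cited-only` (LIT pre-flight 2026-08-25T20:35:30Z: `[folklore]` alone only on private helpers) 2 same-module helper(s) marked `private`
(`pc_inj`, `pp_inj`), and nothing else.  EACH `[cite:]` TAG NAMES THE PRINTED DISPLAY THE DECLARATION SERVES OR TRANSCRIBES —
the proofs are finite-sum bookkeeping ∕ linear algebra of ours; print proves none of them as stated.  Sources READ (renders, LIT `lit/SOURCES.md` v2.75):
[Balaban1984PropagatorsII] = CMP **96** pp. 244–245; [Balaban1984PropagatorsI] p. 18; [Balaban1985BackgroundPropagators] p. 396, p. 428.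

PRINT STATUS.  [Balaban1984PropagatorsII] Lemma 2.4 is PROVED in print for fields on `B(Λ′) ⊂ ℤ^d` vanishing on the contours (2.121), with a constant `γ(d,L)` whose
printed derivation is under repair (pub-balaban GAPS G-B6-09R); the tree's `lemma24_printedShape_kappa1` is a kernel theorem with `κ₁∕(12d²)·L^{−(d+1)}`,
`κ₁ = 2∕(2 + (d−1)(L−1))` (`B6LayerPoincarePair.kappa1`).  The TORUS statement below is not displayed in print ([Balaban1985BackgroundPropagators] p. 428 invokes
Lemma 2.4 on `T₁^{(k)}` by reference); it follows here by transport of structure along the periodic lift of module 1 — no new estimate, same constant.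

WHAT IS PROVED (sorry-free; standard axioms).  `q1_BZ` (the `Q₁`-term (2.125) of the lift at a coarse bond of `Λ′` is the torus double sum at the image bond),
`pc_inj`, `plaq_facts`, `curl_BZ` (the curl of the lift at a plaquette near `Λ′` is the torus circulation at the image plaquette), `pp_inj`, and **`torus2128_of_Zd`**:
for `d ≥ 2`, `L ≥ 1`, `2ρ + 3 ≤ m_i`, every `T ⊇ axialTrees`, every base block `y₁`, every `Y ⊂ y₁ + [1, 2ρ+1]^d` and every real `B` vanishing on `T` and on the
bonds whose block is not in `Y`: `κ₁∕(12d²)·L^{−(d+1)}·Σ_b B_b² ≤ L^{d−2}·Σ_c (L^{−(d+1)}·qSum B c)² + Σ_p (curlSum B p)²` (all sums over the whole torus).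

WHAT THIS IS NOT.  Not NODE O (`B13TermWalkDataOneTorus.ExistsUniformAcrossSmall`, :353), not [Balaban1987RG1] Thm 2 + (0.31) p. 259, not the `γ₀`
sentence of [Balaban1985BackgroundPropagators] p. 428 (whose road is `NodeOGamma0Road.hcoer_of_letters` MODULO its letters), not a new estimate: the weighted `L²` form (E1's `hflat`, [Balaban1985BackgroundPropagators] (3.26)–(3.27) currency) is module 4 `NodeOFlatAxial`; `T` smaller than the block axial trees is not covered.
-/

open scoped BigOperators

noncomputable section

namespace Literature.MathematicalPhysics.QuantumFieldTheory.Balaban1983to89.NodeOTorusLemma24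

open B4Sect5Torus (TSite)
open B9SectCLatticeCarrier (Bond Plaq DirPair shift bpos)
open B7Prop1Explicit (e boxVec)
open B9Eq319QprimeTorus (fineP blockCoord blockCoord_apply_val)
open B9Eq315QTorusOnto (liftSite periodVec perSite_add_periodVec perSite_liftSite)
open B9Eq315QTorus (perSite cornerSite)
open B5Eq155FlatAveragingCommute (shift_perSite)
open B6Elimination (block mem_block)
open B6BondElimination (unitVec contour)
open B6TreeGaugePoincare (Cfg curl)
open B6Lemma24Carrier (lam mem_lam lamBonds mem_lamBonds lamPlaq mem_lamPlaq lamPlaqBase coarseBonds)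
open B6Lemma24PrintedShape (segSum q1 contourSum contourSum_eq_zero_of_bondwise)
open B6Lemma24Kappa (lemma24_printedShape_kappa1)
open B6LayerPoincarePair (kappa1 kappa1_pos)
open NodeOTorusBlocks

variable {d : ℕ}

section Lift

variable (L : ℕ) (m : Fin d → ℕ) [NeZero L] [∀ i, NeZero (m i)] [∀ i, NeZero (fineP L m i)]

omit [NeZero L] in
/-- **The Q₁-term of the lift is the torus (2.125) sum at the image coarse bond.**
[cite: Balaban1984PropagatorsII, (2.125) p.245] -/
theorem q1_BZ {y₁ : TSite d m} {Y' : Finset (TSite d m)} {ρ : ℕ} (hL : 1 ≤ L) (hfit : ∀ i, 2 * ρ + 3 ≤ m i)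
    (hY : ∀ y ∈ Y', ∀ i, 1 ≤ liftSite (y - y₁) i ∧ liftSite (y - y₁) i ≤ ((2 * ρ : ℕ) : ℤ) + 1)
    (B : Bond d (fineP L m) → ℝ) {c : (Fin d → ℤ) × Fin d} (hc : c ∈ coarseBonds L (LamOf L m y₁ Y')) :
    q1 L (BZ L m y₁ B) c = ((L : ℝ) ^ (d + 1))⁻¹ * qSum L m B (perSite m (fun i => c.1 i / L), c.2) := by
  obtain ⟨hb, hdvd⟩ := coarse_facts L m hfit hY hc
  have hmem : ∀ (r : Fin d → Fin L) (s : ℕ), s < L → c.1 + boxVec L r + (s : ℤ) • unitVec c.2 ∈ Rbox L m y₁ := by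
    intro r s hs
    rw [Rbox, mem_box]
    intro i
    obtain ⟨hb1, hb2⟩ := hb i
    have hr' : ((r i : ℕ) : ℤ) < L := by exact_mod_cast (r i).isLt
    have hr0 : (0 : ℤ) ≤ ((r i : ℕ) : ℤ) := by positivity
    have hs' : (s : ℤ) < L := by exact_mod_cast hs
    have hs0 : (0 : ℤ) ≤ (s : ℤ) := by positivity
    simp only [Pi.add_apply, Pi.smul_apply, boxVec, unitVec, smul_eq_mul, mul_ite, mul_one, mul_zero]
    split_ifs <;> constructor <;> linarith
  have hc1 : c.1 = fun i => (L : ℤ) * (c.1 i / L) := funext hdvd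
  have hps : ∀ v, perSite (fineP L m) (c.1 + v) = perSite (fineP L m) (cornerSite L (perSite m fun i => c.1 i / L) + v) := by
    intro v
    conv_lhs => rw [hc1]
    exact perSite_Lmul_add L m _ v
  unfold q1 segSum qSum
  rw [← Finset.mul_sum, sum_block_eq_sum_boxVec (by omega : 0 < L)]
  congr 1
  refine Finset.sum_congr rfl fun r _ => Finset.sum_congr rfl fun s hs => ?_
  have hs' := Finset.mem_range.1 hs
  simp only [BZ, if_pos (hmem r s hs')]
  rw [unitVec_eq_e, add_assoc, hps, ← add_assoc]

omit [NeZero L] [∀ i, NeZero (fineP L m i)] in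
/-- The image coarse bond determines the coarse bond of `Λ′`. [folklore] -/
private theorem pc_inj {y₁ : TSite d m} {Y' : Finset (TSite d m)} {ρ : ℕ} (hL : 1 ≤ L) (hfit : ∀ i, 2 * ρ + 3 ≤ m i)
    (hY : ∀ y ∈ Y', ∀ i, 1 ≤ liftSite (y - y₁) i ∧ liftSite (y - y₁) i ≤ ((2 * ρ : ℕ) : ℤ) + 1)
    {c c' : (Fin d → ℤ) × Fin d} (hc : c ∈ coarseBonds L (LamOf L m y₁ Y')) (hc' : c' ∈ coarseBonds L (LamOf L m y₁ Y'))
    (h : ((perSite m (fun i => c.1 i / L), c.2) : Bond d m) = (perSite m (fun i => c'.1 i / L), c'.2)) : c = c' := by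
  have hL0 : (0 : ℤ) < L := by exact_mod_cast hL
  have hbox : ∀ {c : (Fin d → ℤ) × Fin d}, c ∈ coarseBonds L (LamOf L m y₁ Y') →
      (fun i => c.1 i / L) ∈ box (liftSite y₁) m := by
    intro c hc
    obtain ⟨hb, -⟩ := coarse_facts L m hfit hY hc
    rw [mem_box]
    intro i
    obtain ⟨hb1, hb2⟩ := hb i
    have hcs : cornerSite L y₁ i = L * liftSite y₁ i := rfl
    have hf : ((fineP L m i : ℕ) : ℤ) = L * m i := by simp only [fineP]; push_cast; ring
    rw [hcs] at hb1 hb2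
    rw [hf] at hb2
    exact ⟨Int.le_ediv_of_mul_le hL0 (by linarith [mul_comm (L : ℤ) (liftSite y₁ i)]),
      Int.ediv_lt_of_lt_mul hL0 (by nlinarith)⟩
  obtain ⟨h1, h2⟩ := Prod.mk.injEq _ _ _ _ ▸ h
  have hw := perSite_injOn m (hbox hc) (hbox hc') h1
  obtain ⟨-, hd1⟩ := coarse_facts L m hfit hY hc
  obtain ⟨-, hd2⟩ := coarse_facts L m hfit hY hc'
  refine Prod.ext (funext fun i => ?_) h2
  rw [hd1 i, hd2 i, show c.1 i / L = c'.1 i / L from congrFun hw i]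

omit [NeZero L] [∀ i, NeZero (m i)] [∀ i, NeZero (fineP L m i)] in
/-- **Plaquettes near `Λ′`**: base coordinates within `[L a_i + L − 1, L a_i + L m_i − L − 1]`.
[cite: Balaban1984PropagatorsII, Lemma 2.4 (2.128) p.245] -/
theorem plaq_facts {y₁ : TSite d m} {Y' : Finset (TSite d m)} {ρ : ℕ} (hfit : ∀ i, 2 * ρ + 3 ≤ m i)
    (hY : ∀ y ∈ Y', ∀ i, 1 ≤ liftSite (y - y₁) i ∧ liftSite (y - y₁) i ≤ ((2 * ρ : ℕ) : ℤ) + 1)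
    {p : (Fin d → ℤ) × Fin d × Fin d} (hp : p ∈ lamPlaq L (LamOf L m y₁ Y')) (i : Fin d) :
    cornerSite L y₁ i + L - 1 ≤ p.1 i ∧ p.1 i + L + 1 ≤ cornerSite L y₁ i + (fineP L m i : ℤ) := by
  obtain ⟨hbase, -⟩ := mem_lamPlaq.1 hp
  unfold lamPlaqBase at hbase
  obtain ⟨y', hy', hz⟩ := Finset.mem_biUnion.1 hbase
  have hzi := Finset.mem_Ico.1 (Fintype.mem_piFinset.1 hz i)
  obtain ⟨hw1, hw2⟩ := window L m hfit hY hy' i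
  constructor <;> linarith [hzi.1, hzi.2]

omit [NeZero L] [∀ i, NeZero (m i)] in
/-- **The circulation of the lift is the torus circulation at the image plaquette.**
[cite: Balaban1984PropagatorsI, (1.4) p.18] -/
theorem curl_BZ {y₁ : TSite d m} {Y' : Finset (TSite d m)} {ρ : ℕ} (hL : 1 ≤ L) (hfit : ∀ i, 2 * ρ + 3 ≤ m i)
    (hY : ∀ y ∈ Y', ∀ i, 1 ≤ liftSite (y - y₁) i ∧ liftSite (y - y₁) i ≤ ((2 * ρ : ℕ) : ℤ) + 1)
    (B : Bond d (fineP L m) → ℝ) {p : (Fin d → ℤ) × Fin d × Fin d} (hp : p ∈ lamPlaq L (LamOf L m y₁ Y'))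
    (hlt : p.2.1 < p.2.2) :
    curl (BZ L m y₁ B) p.1 p.2.1 p.2.2 = curlSum B (perSite (fineP L m) p.1, ⟨(p.2.1, p.2.2), hlt⟩) := by
  have hf := plaq_facts L m hfit hY hp
  have hL1 : (1 : ℤ) ≤ L := by exact_mod_cast hL
  have hm0 : p.1 ∈ Rbox L m y₁ := by
    rw [Rbox, mem_box]
    intro i
    obtain ⟨h1, h2⟩ := hf i
    constructor <;> linarith
  have hm1 : ∀ j : Fin d, p.1 + unitVec j ∈ Rbox L m y₁ := by
    intro j
    rw [Rbox, mem_box]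
    intro i
    obtain ⟨h1, h2⟩ := hf i
    simp only [Pi.add_apply, unitVec]
    split_ifs <;> constructor <;> linarith
  simp only [curl, BZ, if_pos hm0, if_pos (hm1 _)]
  simp only [curlSum, shift_perSite, unitVec_eq_e]
  ring

omit [NeZero L] [∀ i, NeZero (m i)] in
/-- The image plaquette determines the plaquette near `Λ′`. [folklore] -/
private theorem pp_inj {y₁ : TSite d m} {Y' : Finset (TSite d m)} {ρ : ℕ} (hL : 1 ≤ L) (hfit : ∀ i, 2 * ρ + 3 ≤ m i)
    (hY : ∀ y ∈ Y', ∀ i, 1 ≤ liftSite (y - y₁) i ∧ liftSite (y - y₁) i ≤ ((2 * ρ : ℕ) : ℤ) + 1)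
    {p p' : (Fin d → ℤ) × Fin d × Fin d} (hp : p ∈ lamPlaq L (LamOf L m y₁ Y'))
    (hp' : p' ∈ lamPlaq L (LamOf L m y₁ Y')) (hlt : p.2.1 < p.2.2) (hlt' : p'.2.1 < p'.2.2)
    (h : ((perSite (fineP L m) p.1, ⟨(p.2.1, p.2.2), hlt⟩) : B9SectCLatticeCarrier.Plaq d (fineP L m)) =
      (perSite (fineP L m) p'.1, ⟨(p'.2.1, p'.2.2), hlt'⟩)) : p = p' := by
  have hL1 : (1 : ℤ) ≤ L := by exact_mod_cast hL
  have hbox : ∀ {p : (Fin d → ℤ) × Fin d × Fin d}, p ∈ lamPlaq L (LamOf L m y₁ Y') →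
      p.1 ∈ box (fun i => cornerSite L y₁ i + L - 1) (fineP L m) := by
    intro p hp
    rw [mem_box]
    intro i
    obtain ⟨h1, h2⟩ := plaq_facts L m hfit hY hp i
    constructor <;> linarith
  obtain ⟨h1, h2⟩ := Prod.mk.injEq _ _ _ _ ▸ h
  have hz := perSite_injOn (fineP L m) (hbox hp) (hbox hp') h1
  have h2' := congrArg Subtype.val h2
  obtain ⟨h21, h22⟩ := Prod.mk.injEq _ _ _ _ ▸ h2'
  exact Prod.ext hz (Prod.ext h21 h22)

/-! ## §5  The unit-weight torus form of (2.128) from the `ℤ^d` theorem -/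

omit [NeZero L] in
/-- **[B6] Lemma 2.4 (2.128)_{κ₁} ON THE TORUS, unit weights** — the hypothesis `h2128` of companion 7's
`Rreal_of_unitWeight` with `k = (κ₁/(12d²))·L^{-(d+1)}`, `w_Q = L^{d−2}`: for `d ≥ 2`, `L ≥ 1`, `2ρ + 3 ≤ m_i` and every
`T ⊇ axialTrees`, every base block `y₁`, every `Y` in the box `y₁ + [1, 2ρ+1]^d`, and every real bond function `B` on the
fine torus vanishing on `T` and off the blocks of `Y`:
`(κ₁/(12d²)) L^{-(d+1)} Σ_b B_b² ≤ L^{d−2} Σ_c (L^{-(d+1)} qSum B c)² + Σ_p (curlSum B p)²` — derived from the tree's `ℤ^d`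
theorem `B6Lemma24Kappa.lemma24_printedShape_kappa1` by the periodic lift `B ↦ B^ℤ`.
[cite: Balaban1984PropagatorsII, Lemma 2.4 (2.128) p.245; Balaban1985BackgroundPropagators, (3.35)–(3.36) p.396] -/
theorem torus2128_of_Zd (hd : 2 ≤ d) (hL : 1 ≤ L) {ρ : ℕ} (hfit : ∀ i, 2 * ρ + 3 ≤ m i)
    (T : Set (Bond d (fineP L m))) (hTax : axialTrees L m ⊆ T) :
    ∀ (y₁ : TSite d m) (Y : Set (TSite d m)),
      (∀ y ∈ Y, ∀ i, 1 ≤ liftSite (y - y₁) i ∧ liftSite (y - y₁) i ≤ ((2 * ρ : ℕ) : ℤ) + 1) →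
      ∀ B : Bond d (fineP L m) → ℝ, (∀ b ∈ T, B b = 0) → (∀ b, blockCoord L m (bpos b) ∉ Y → B b = 0) →
        kappa1 d L / (12 * (d : ℝ) ^ 2) * (L : ℝ) ^ (-((d : ℝ) + 1)) * ∑ b, B b ^ 2 ≤
          (L : ℝ) ^ ((d : ℝ) - 2) * ∑ c, (((L : ℝ) ^ (d + 1))⁻¹ * qSum L m B c) ^ 2 + ∑ p, curlSum B p ^ 2 := by
  haveI : NeZero L := ⟨by omega⟩
  intro y₁ Y hY B hT hY0
  classical
  set Y' : Finset (TSite d m) := Finset.univ.filter (· ∈ Y) with hY'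
  have hmemY' : ∀ y, y ∈ Y' ↔ y ∈ Y := fun y => by simp [hY']
  have hYf : ∀ y ∈ Y', ∀ i, 1 ≤ liftSite (y - y₁) i ∧ liftSite (y - y₁) i ≤ ((2 * ρ : ℕ) : ℤ) + 1 :=
    fun y hy => hY y ((hmemY' y).1 hy)
  set Λ' := LamOf L m y₁ Y' with hΛ'
  have hΛ : ∀ y' ∈ Λ', ∀ i, (L : ℤ) ∣ y' i := by
    intro y' hy' i
    obtain ⟨y, -, rfl⟩ := Finset.mem_image.1 hy'
    exact ⟨_, rfl⟩
  -- (2.128) hypotheses for the lift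
  have hB0 : ∀ b, b ∉ lamBonds L Λ' → BZ L m y₁ B b = 0 := by
    intro b hb
    simp only [BZ]
    split_ifs with hb1
    · apply hY0
      intro hy
      exact hb (mem_lamBonds.2 (Or.inl (mem_lam_of_blockCoord L m y₁ Y' hb1 ((hmemY' _).2 hy))))
    · rfl
  have h2121 : ∀ y' ∈ Λ', ∀ x ∈ B6Elimination.block L y', contourSum L (BZ L m y₁ B) y' x = 0 := by
    intro y' hy'
    apply contourSum_eq_zero_of_bondwise
    intro x hx b hb
    simp only [BZ]
    split_ifs with hb1
    · exact hT _ (hTax ⟨y', hΛ y' hy', x, hx, b, hb, rfl⟩)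
    · rfl
  have hZ := lemma24_printedShape_kappa1 (E := lamBonds L Λ' ∪ Rbox L m y₁ ×ˢ Finset.univ) (P := lamPlaq L Λ')
    hd hL hΛ (BZ L m y₁ B) hB0 h2121 Finset.subset_union_left (Finset.Subset.refl _)
  -- the left side: reindex the torus by the fundamental box
  have hLHS : ∑ b, B b ^ 2 ≤ ∑ b ∈ lamBonds L Λ' ∪ Rbox L m y₁ ×ˢ Finset.univ, BZ L m y₁ B b ^ 2 :=
    calc ∑ b, B b ^ 2 = ∑ x : TSite d (fineP L m), ∑ μ : Fin d, B (x, μ) ^ 2 := Fintype.sum_prod_type _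
      _ = ∑ z ∈ Rbox L m y₁, ∑ μ : Fin d, B (perSite (fineP L m) z, μ) ^ 2 :=
          sum_torus_eq_sum_box (fineP L m) (cornerSite L y₁) _
      _ = ∑ z ∈ Rbox L m y₁, ∑ μ : Fin d, BZ L m y₁ B (z, μ) ^ 2 :=
          Finset.sum_congr rfl fun z hz => by simp only [BZ, if_pos hz]
      _ = ∑ b ∈ Rbox L m y₁ ×ˢ (Finset.univ : Finset (Fin d)), BZ L m y₁ B b ^ 2 :=
          (Finset.sum_product (Rbox L m y₁) Finset.univ (fun b => BZ L m y₁ B b ^ 2)).symm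
      _ ≤ _ := Finset.sum_le_sum_of_subset_of_nonneg Finset.subset_union_right fun _ _ _ => sq_nonneg _
  -- the Q side
  have hQ : ∑ c ∈ coarseBonds L Λ', q1 L (BZ L m y₁ B) c ^ 2 ≤ ∑ c, (((L : ℝ) ^ (d + 1))⁻¹ * qSum L m B c) ^ 2 :=
    calc ∑ c ∈ coarseBonds L Λ', q1 L (BZ L m y₁ B) c ^ 2
        = ∑ c ∈ coarseBonds L Λ',
            (((L : ℝ) ^ (d + 1))⁻¹ * qSum L m B (perSite m (fun i => c.1 i / L), c.2)) ^ 2 :=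
          Finset.sum_congr rfl fun c hc => by rw [q1_BZ L m hL hfit hYf B hc]
      _ = ∑ ct ∈ (coarseBonds L Λ').image (fun c => ((perSite m (fun i => c.1 i / L), c.2) : Bond d m)),
            (((L : ℝ) ^ (d + 1))⁻¹ * qSum L m B ct) ^ 2 :=
          (Finset.sum_image (f := fun ct : Bond d m => (((L : ℝ) ^ (d + 1))⁻¹ * qSum L m B ct) ^ 2)
            fun c hc c' hc' h => pc_inj L m hL hfit hYf hc hc' h).symm
      _ ≤ _ := Finset.sum_le_univ_sum_of_nonneg fun _ => sq_nonneg _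
  -- the plaquette side
  let q₀ : DirPair d := ⟨(⟨0, by omega⟩, ⟨1, by omega⟩), by show (⟨0, _⟩ : Fin d) < ⟨1, _⟩; exact Fin.mk_lt_mk.2 zero_lt_one⟩
  let pp : (Fin d → ℤ) × Fin d × Fin d → B9SectCLatticeCarrier.Plaq d (fineP L m) := fun p =>
    (perSite (fineP L m) p.1, if h : p.2.1 < p.2.2 then ⟨(p.2.1, p.2.2), h⟩ else q₀)
  have hpp : ∀ p (hp : p ∈ lamPlaq L Λ'), pp p = (perSite (fineP L m) p.1, ⟨(p.2.1, p.2.2), (mem_lamPlaq.1 hp).2⟩) :=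
    fun p hp => by simp only [pp, dif_pos (mem_lamPlaq.1 hp).2]
  have hP : ∑ p ∈ lamPlaq L Λ', curl (BZ L m y₁ B) p.1 p.2.1 p.2.2 ^ 2 ≤ ∑ p, curlSum B p ^ 2 :=
    calc ∑ p ∈ lamPlaq L Λ', curl (BZ L m y₁ B) p.1 p.2.1 p.2.2 ^ 2
        = ∑ p ∈ lamPlaq L Λ', curlSum B (pp p) ^ 2 :=
          Finset.sum_congr rfl fun p hp => by rw [hpp p hp, curl_BZ L m hL hfit hYf B hp]
      _ = ∑ pt ∈ (lamPlaq L Λ').image pp, curlSum B pt ^ 2 := by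
          refine (Finset.sum_image (f := fun pt : B9SectCLatticeCarrier.Plaq d (fineP L m) => curlSum B pt ^ 2) fun p hp p' hp' h => ?_).symm
          rw [hpp p hp, hpp p' hp'] at h
          exact pp_inj L m hL hfit hYf hp hp' _ _ h
      _ ≤ _ := Finset.sum_le_univ_sum_of_nonneg fun _ => sq_nonneg _
  -- combine
  have hk : 0 ≤ kappa1 d L / (12 * (d : ℝ) ^ 2) * (L : ℝ) ^ (-((d : ℝ) + 1)) :=
    mul_nonneg (div_nonneg (kappa1_pos (by omega) hL).le (by positivity)) (Real.rpow_nonneg (Nat.cast_nonneg _) _)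
  have hw : 0 ≤ (L : ℝ) ^ ((d : ℝ) - 2) := Real.rpow_nonneg (Nat.cast_nonneg _) _
  calc kappa1 d L / (12 * (d : ℝ) ^ 2) * (L : ℝ) ^ (-((d : ℝ) + 1)) * ∑ b, B b ^ 2
      ≤ kappa1 d L / (12 * (d : ℝ) ^ 2) * (L : ℝ) ^ (-((d : ℝ) + 1)) *
          ∑ b ∈ lamBonds L Λ' ∪ Rbox L m y₁ ×ˢ Finset.univ, BZ L m y₁ B b ^ 2 :=
        mul_le_mul_of_nonneg_left hLHS hk
    _ ≤ (L : ℝ) ^ ((d : ℝ) - 2) * ∑ c ∈ coarseBonds L Λ', q1 L (BZ L m y₁ B) c ^ 2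
          + ∑ p ∈ lamPlaq L Λ', curl (BZ L m y₁ B) p.1 p.2.1 p.2.2 ^ 2 := hZ
    _ ≤ _ := add_le_add (mul_le_mul_of_nonneg_left hQ hw) hP

end Lift

end Literature.MathematicalPhysics.QuantumFieldTheory.Balaban1983to89.NodeOTorusLemma24

end
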